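import Mathlib
import Summits.ValiantsHypothesis.ValiantsHypothesis.Theorems.NewtonUnitEquationsTwoProductsRankOneFourLawPlanar
import Summits.ValiantsHypothesis.ValiantsHypothesis.Theorems.TwoProducts.Negative.ClassCoverSharedAlphabet
import HarnessLib

/-!
# `TwoProducts` (stmt-ValiantsHypothesis-5906), line `relation_ladder` — NEGATIVE lane: the TWO-LETTER shape `α = 2β` escapes
# every rank-one exclusion clause of the residual (V15 … V18)

Helper file of the Negative lane (val-neg-1 g3; `--supports stmt-ValiantsHypothesis-5906`; closes NO item).  Kernel form of the
first-inhabitant analysis (evidence #47/#48/#56 on the item): take a SHARED alphabet `A l = E` containing a letter `β ≠ 0` and its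
double `α = 2 • β`, and two distinct positions `i ≠ j` (so `m ≥ 2`).  The swap `(α at i) ~ (β at i, β at j)` is an additive
coincidence whose letter multisets differ by `e_α − 2 e_β`.  Consequently

* `rankOne_agree_off_pair` — ANY rank-one datum `(ρp, ρm)` with `RankOneCoincidences A ρp ρm` (tree, `…RankOneFourLawPlanar`)
  agrees off the pair: `ρp e = ρm e` for every letter `e ∉ {α, β}`;
* `not_rankOne_of_three_disagreements` — no rank-one datum disagreeing at three distinct letters fits the family;
* hence the family satisfies ALL FIVE `¬`-clauses of `ResidualLawV18` (`Cruxes/TwoProducts/Lines/relation_ladder.lean` v18), whose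
  bodies are restated VERBATIM as the negated statements below (Cruxes files are not importable): `not_fourTermRankOne`
  (`α'+β' = γ'+δ'`), `not_threeTermRankOne` (`α' = β'+γ'`, R6b), `not_threeTermAPRankOne` (`α'+γ' = 2β'`, R6c),
  `not_threeTermFreeRankOne` (`α' = qβ' + rγ'`, R7a), `not_threeTermHomRankOne` (`qα' + rγ' = (q+r)β'`, R6d) — each clause's datum
  disagrees at its three (or four) distinct relation letters.

READING (information for the line owner, not an objection): no rung whose hypothesis is a rank-one datum supported on ≥ 3 letters
removes the two-letter common-direction families; together with `ClassCoverBound.classCover_lower_bound` (HYP2 automatic) these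
families inhabit the residual's hypotheses from the HYP1 frontier `t₀(m)` on.  Honest framing: `TwoProducts` (5906), the residual LAW
and VP ≠ VNP are NOT proved here and are not claimed. [folklore]
-/

namespace Summit.ValiantsHypothesis.Theorems.TwoProducts.Negative.TwoLetterEscape

open Finset
open Summit.ValiantsHypothesis.ValiantsHypothesis.Theorems.NewtonUnitEquations.TwoProducts.FormalLogLinearisation (Expo)
open Summit.ValiantsHypothesis.ValiantsHypothesis.Theorems.NewtonUnitEquations.TwoProducts.PlanarCell (tuples)
open Summit.ValiantsHypothesis.ValiantsHypothesis.Theorems.NewtonUnitEquations.TwoProducts.PermutationType (msetT RankOneCoincidences)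
open Summit.ValiantsHypothesis.Theorems.TwoProducts.Negative.ClassCoverBound

variable {m : ℕ}

/-- Letter multiset of a swap tuple: one copy of each non-zero entry. [folklore] -/
theorem msetT_swap {i j : Fin m} (hij : i ≠ j) (x y : Expo) :
    msetT (Pi.single i x + Pi.single j y : Fin m → Expo) =
      (if x = 0 then 0 else Finsupp.single x 1) + (if y = 0 then 0 else Finsupp.single y 1) := by
  unfold msetT
  rw [Fintype.sum_eq_add i j hij]
  · rw [swap_at_i hij, swap_at_j hij]
  · intro l hl
    rw [swap_of_ne hl.1 hl.2, if_pos rfl]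

/-- `2 • β ≠ 0` for `β ≠ 0`. [folklore] -/
theorem two_nsmul_ne_zero {β : Expo} (hβ0 : β ≠ 0) : 2 • β ≠ 0 := by
  obtain ⟨s, hs⟩ := Finsupp.ne_iff.mp hβ0
  intro h0
  have := DFunLike.congr_fun h0 s
  simp only [Finsupp.smul_apply, smul_eq_mul, Finsupp.coe_zero, Pi.zero_apply] at this hs
  omega

/-- `2 • β ≠ β` for `β ≠ 0`. [folklore] -/
theorem two_nsmul_ne_self {β : Expo} (hβ0 : β ≠ 0) : 2 • β ≠ β := by
  obtain ⟨s, hs⟩ := Finsupp.ne_iff.mp hβ0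
  intro h0
  have := DFunLike.congr_fun h0 s
  simp only [Finsupp.smul_apply, smul_eq_mul, Finsupp.coe_zero, Pi.zero_apply] at this hs
  omega

/-- Cancellation step: from `P + k•ρp = Q + k•ρm` with `P α ≠ Q α` (so `k ≠ 0`) and `P e = Q e = 0`, get `ρp e = ρm e`. [folklore] -/
theorem agree_of_shift {P Q ρp ρm : Expo →₀ ℕ} {k : ℕ} {α e : Expo} (hα : P α ≠ Q α) (hPe : P e = 0) (hQe : Q e = 0)
    (h : P + k • ρp = Q + k • ρm) : ρp e = ρm e := by
  have hk : k ≠ 0 := by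
    rintro rfl
    simp only [zero_smul, add_zero] at h
    exact hα (by rw [h])
  have he := DFunLike.congr_fun h e
  simp only [Finsupp.add_apply, Finsupp.smul_apply, smul_eq_mul, hPe, hQe, zero_add] at he
  exact Nat.eq_of_mul_eq_mul_left (Nat.pos_of_ne_zero hk) he

/-- **Off-pair agreement.**  In a shared alphabet containing `β ≠ 0` and `α = 2•β`, with two distinct positions, every rank-one datum
agrees at every letter other than `α, β`. [folklore] -/
theorem rankOne_agree_off_pair {E : Finset Expo} {A : Fin m → Finset Expo} (hA : ∀ l, A l = E) {α β : Expo} (hα : α ∈ E)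
    (hβ : β ∈ E) (hβ0 : β ≠ 0) (hαβ : α = 2 • β) {i j : Fin m} (hij : i ≠ j) {ρp ρm : Expo →₀ ℕ}
    (h : RankOneCoincidences A ρp ρm) {e : Expo} (heα : e ≠ α) (heβ : e ≠ β) : ρp e = ρm e := by
  have hα0 : α ≠ 0 := hαβ ▸ two_nsmul_ne_zero hβ0
  have hαβ' : α ≠ β := hαβ ▸ two_nsmul_ne_self hβ0
  have ha := swap_mem_tuples hA hij (Finset.mem_insert_of_mem hα) (Finset.mem_insert_self (0 : Expo) E)
  have hb := swap_mem_tuples hA hij (Finset.mem_insert_of_mem hβ) (Finset.mem_insert_of_mem hβ)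
  have hsum : ∑ l, (Pi.single i α + Pi.single j (0 : Expo) : Fin m → Expo) l =
      ∑ l, (Pi.single i β + Pi.single j β : Fin m → Expo) l := by
    rw [sum_swap, sum_swap, add_zero, hαβ, two_nsmul]
  have hPa : msetT (Pi.single i α + Pi.single j (0 : Expo) : Fin m → Expo) = Finsupp.single α 1 := by
    rw [msetT_swap hij, if_neg hα0, if_pos rfl, add_zero]
  have hPb : msetT (Pi.single i β + Pi.single j β : Fin m → Expo) = Finsupp.single β 1 + Finsupp.single β 1 := by
    rw [msetT_swap hij, if_neg hβ0]
  have h1 : (Finsupp.single α 1 : Expo →₀ ℕ) α ≠ (Finsupp.single β 1 + Finsupp.single β 1 : Expo →₀ ℕ) α := by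
    simp [Ne.symm hαβ']
  have h2 : (Finsupp.single α 1 : Expo →₀ ℕ) e = 0 := by simp [Ne.symm heα]
  have h3 : (Finsupp.single β 1 + Finsupp.single β 1 : Expo →₀ ℕ) e = 0 := by simp [Ne.symm heβ]
  obtain ⟨k, hk | hk⟩ := h _ ha _ hb hsum
  · rw [hPa, hPb] at hk
    exact agree_of_shift h1 h2 h3 hk
  · rw [hPa, hPb] at hk
    exact agree_of_shift h1.symm h3 h2 hk

/-- **Three disagreements kill rank one.**  A datum `(ρp, ρm)` disagreeing at three distinct letters is not a rank-one description of
the family (two of the three letters would have to be `α, β`, the third cannot). [folklore] -/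
theorem not_rankOne_of_three_disagreements {E : Finset Expo} {A : Fin m → Finset Expo} (hA : ∀ l, A l = E) {α β : Expo}
    (hα : α ∈ E) (hβ : β ∈ E) (hβ0 : β ≠ 0) (hαβ : α = 2 • β) {i j : Fin m} (hij : i ≠ j) {ρp ρm : Expo →₀ ℕ}
    {e₁ e₂ e₃ : Expo} (h12 : e₁ ≠ e₂) (h13 : e₁ ≠ e₃) (h23 : e₂ ≠ e₃) (d1 : ρp e₁ ≠ ρm e₁) (d2 : ρp e₂ ≠ ρm e₂)
    (d3 : ρp e₃ ≠ ρm e₃) : ¬ RankOneCoincidences A ρp ρm := by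
  intro h
  have agree : ∀ e, e ≠ α → e ≠ β → ρp e = ρm e := fun e h1 h2 => rankOne_agree_off_pair hA hα hβ hβ0 hαβ hij h h1 h2
  have c1 : e₁ = α ∨ e₁ = β := by
    by_contra hc; rw [not_or] at hc; exact d1 (agree e₁ hc.1 hc.2)
  have c2 : e₂ = α ∨ e₂ = β := by
    by_contra hc; rw [not_or] at hc; exact d2 (agree e₂ hc.1 hc.2)
  have c3 : e₃ = α ∨ e₃ = β := by
    by_contra hc; rw [not_or] at hc; exact d3 (agree e₃ hc.1 hc.2)
  rcases c1 with h1 | h1 <;> rcases c2 with h2 | h2 <;> rcases c3 with h3 | h3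
  all_goals first
    | exact h12 (h1.trans h2.symm)
    | exact h13 (h1.trans h3.symm)
    | exact h23 (h2.trans h3.symm)

section Clauses

variable {E : Finset Expo} {A : Fin m → Finset Expo} (hA : ∀ l, A l = E) {α β : Expo} (hα : α ∈ E) (hβ : β ∈ E) (hβ0 : β ≠ 0)
  (hαβ : α = 2 • β) {i j : Fin m} (hij : i ≠ j)
include hA hα hβ hβ0 hαβ hij

/-- The family is NOT `FourTermRankOne` (body of the v18 skeleton's def, verbatim). [folklore] -/
theorem not_fourTermRankOne :
    ¬ ∃ α β γ δ : Expo, α ≠ β ∧ α ≠ γ ∧ α ≠ δ ∧ β ≠ γ ∧ β ≠ δ ∧ γ ≠ δ ∧ α + β = γ + δ ∧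
      RankOneCoincidences A (Finsupp.single γ 1 + Finsupp.single δ 1) (Finsupp.single α 1 + Finsupp.single β 1) := by
  rintro ⟨a, b, c, d, hab, hac, had, hbc, hbd, hcd, -, hR⟩
  refine not_rankOne_of_three_disagreements hA hα hβ hβ0 hαβ hij hab hac hbc ?_ ?_ ?_ hR
  · simp [hab, Ne.symm hac, Ne.symm had]
  · simp [hab, Ne.symm hbc, Ne.symm hbd]
  · simp [hac, hbc, hcd]

/-- The family is NOT `ThreeTermRankOne` (R6b's hypothesis; body verbatim). [folklore] -/
theorem not_threeTermRankOne :
    ¬ ∃ α β γ : Expo, α ≠ β ∧ α ≠ γ ∧ β ≠ γ ∧ α = β + γ ∧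
      RankOneCoincidences A (Finsupp.single β 1 + Finsupp.single γ 1) (Finsupp.single α 1) := by
  rintro ⟨a, b, c, hab, hac, hbc, -, hR⟩
  refine not_rankOne_of_three_disagreements hA hα hβ hβ0 hαβ hij hab hac hbc ?_ ?_ ?_ hR
  · simp [Ne.symm hab, Ne.symm hac]
  · simp [hab, Ne.symm hbc]
  · simp [hac, hbc]

/-- The family is NOT `ThreeTermAPRankOne` (R6c's hypothesis; body verbatim). [folklore] -/
theorem not_threeTermAPRankOne :
    ¬ ∃ α β γ : Expo, α ≠ β ∧ α ≠ γ ∧ β ≠ γ ∧ α + γ = β + β ∧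
      RankOneCoincidences A (Finsupp.single β 2) (Finsupp.single α 1 + Finsupp.single γ 1) := by
  rintro ⟨a, b, c, hab, hac, hbc, -, hR⟩
  refine not_rankOne_of_three_disagreements hA hα hβ hβ0 hαβ hij hab hac hbc ?_ ?_ ?_ hR
  · simp [Ne.symm hab, hac]
  · simp [hab, Ne.symm hbc]
  · simp [hbc, Ne.symm hac]

/-- The family is NOT `ThreeTermFreeRankOne` (R7a's hypothesis `α' = qβ' + rγ'`, `q, r ≥ 1`; body verbatim). [folklore] -/
theorem not_threeTermFreeRankOne :
    ¬ ∃ (α β γ : Expo) (q r : ℕ), 1 ≤ q ∧ 1 ≤ r ∧ α ≠ β ∧ α ≠ γ ∧ β ≠ γ ∧ α = q • β + r • γ ∧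
      RankOneCoincidences A (Finsupp.single β q + Finsupp.single γ r) (Finsupp.single α 1) := by
  rintro ⟨a, b, c, q, r, hq, hr, hab, hac, hbc, -, hR⟩
  have hq0 : q ≠ 0 := by omega
  have hr0 : r ≠ 0 := by omega
  refine not_rankOne_of_three_disagreements hA hα hβ hβ0 hαβ hij hab hac hbc ?_ ?_ ?_ hR
  · simp [Ne.symm hab, Ne.symm hac]
  · simp [hab, Ne.symm hbc, hq0]
  · simp [hac, hbc, hr0]

/-- The family is NOT `ThreeTermHomRankOne` (R6d's hypothesis `qα' + rγ' = (q+r)β'`; body verbatim). [folklore] -/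
theorem not_threeTermHomRankOne :
    ¬ ∃ α β γ : Expo, ∃ q r : ℕ, α ≠ β ∧ α ≠ γ ∧ β ≠ γ ∧ 1 ≤ q ∧ 1 ≤ r ∧ q • α + r • γ = (q + r) • β ∧
      RankOneCoincidences A (Finsupp.single β (q + r)) (Finsupp.single α q + Finsupp.single γ r) := by
  rintro ⟨a, b, c, q, r, hab, hac, hbc, hq, hr, -, hR⟩
  refine not_rankOne_of_three_disagreements hA hα hβ hβ0 hαβ hij hab hac hbc ?_ ?_ ?_ hR
  · simp [Ne.symm hab, hac]; omega
  · simp [hab, Ne.symm hbc]; omega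
  · simp [hbc, Ne.symm hac]; omega

end Clauses

end Summit.ValiantsHypothesis.Theorems.TwoProducts.Negative.TwoLetterEscape
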